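import Summits.Ventures.PercRepro.RankLevelSetLevelNineArithCubeBE
import Summits.Ventures.PercRepro.RankLevelSetLevelNineArithCubeBF
import Summits.Ventures.PercRepro.RankLevelSetLevelNineArithCubeBG
import Summits.Ventures.PercRepro.RankLevelSetLevelNineArithCubeBH
import Summits.Ventures.PercRepro.RankLevelSetLevelNineArithCubeBI
import Summits.Ventures.PercRepro.RankLevelSetLevelNineArithCubeBJ
import Summits.Ventures.PercRepro.RankLevelSetLevelNineArithCubeBK
import Summits.Ventures.PercRepro.RankLevelSetLevelNineArithCubeBL
import Summits.Ventures.PercRepro.RankLevelSetLevelNineArithCubeBM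
import Summits.Ventures.PercRepro.RankLevelSetLevelNineArithCubeBN

/-!
# PercRepro — THE LEVEL-`9` DISPATCHER OF THE PARTITION CHAIN WITH THE CUBIC MULTIPLICITY, PART ZD: `(P_d)` for `250 ≤ d ≤ 329`,
`p ≥ 381` (p4, gen 16; a feeder for S4). Axioms: standard.
-/

namespace PercRepro

namespace ThmN

/-- `(P_d)` at level `9` for `250 ≤ d ≤ 329`, `p ≥ 381`, in `ℚ`. -/
theorem level_nine_poly_cube_ZD (d : ℕ) (hd1 : 250 ≤ d) (hd2 : d ≤ 329) (p : ℕ) (hp : 381 ≤ p) :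
    8 * ((((p + d).choose 9 : ℕ) : ℚ) + (∑ j ∈ Finset.range (d - 9), ((Nat.choose (min 309 (max ((d + min 151 d) / 2 + 1) (min 150 (d - 1) + 2) - 2)) j : ℕ) : ℚ) / (((j + 1) + 3 * (j + 1).choose 2 + 3 * (j + 1).choose 3 : ℕ) : ℚ)) *
      (((d * (d + 1) / 2 : ℕ) : ℚ) * ((p + d).choose 7 : ℚ) + ((d * (d + 1) * (d + 2) / 3 : ℕ) : ℚ) * ((p + d).choose 6 : ℚ) + (((d + 4).choose 5 : ℕ) : ℚ) * ((p + d).choose 5 : ℚ) + (((d + 5).choose 6 : ℕ) : ℚ) * ((p + d).choose 4 : ℚ) + (((d + 6).choose 7 : ℕ) : ℚ) * ((p + d).choose 3 : ℚ) + (((d + 7).choose 8 : ℕ) : ℚ) * ((p + d).choose 2 : ℚ) + (((d + 8).choose 9 : ℕ) : ℚ) * (p + d : ℚ) + (((d + 9).choose 10 : ℕ) : ℚ)) +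
      ((∑ j ∈ Finset.range (d - 9), ((Nat.choose (min 319 (9 + d) - 10) j : ℕ) : ℚ) / (((j + 1) + 3 * (j + 1).choose 2 + 3 * (j + 1).choose 3 : ℕ) : ℚ)) - (∑ j ∈ Finset.range (d - 9), ((Nat.choose (min 150 (d - 1)) j : ℕ) : ℚ) / (((j + 1) + 3 * (j + 1).choose 2 + 3 * (j + 1).choose 3 : ℕ) : ℚ))) *
      ((d * (d + 1) / 2 * (min 319 (9 + d)).choose 7 + d * (d + 1) * (d + 2) / 3 * (min 319 (9 + d)).choose 6 + (d + 4).choose 5 * (min 319 (9 + d)).choose 5 + (d + 5).choose 6 * (min 319 (9 + d)).choose 4 + (d + 6).choose 7 * (min 319 (9 + d)).choose 3 + (d + 7).choose 8 * (min 319 (9 + d)).choose 2 + (d + 8).choose 9 * (min 319 (9 + d)) + (d + 9).choose 10 : ℕ) : ℚ)) ≤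
      7 * 2 ^ (d - 9) * (((p + 9).choose 9 : ℕ) : ℚ) := by
  interval_cases d
  · exact level_nine_poly_cube_250 p hp
  · exact level_nine_poly_cube_251 p hp
  · exact level_nine_poly_cube_252 p hp
  · exact level_nine_poly_cube_253 p hp
  · exact level_nine_poly_cube_254 p hp
  · exact level_nine_poly_cube_255 p hp
  · exact level_nine_poly_cube_256 p hp
  · exact level_nine_poly_cube_257 p hp
  · exact level_nine_poly_cube_258 p hp
  · exact level_nine_poly_cube_259 p hp
  · exact level_nine_poly_cube_260 p hp
  · exact level_nine_poly_cube_261 p hp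
  · exact level_nine_poly_cube_262 p hp
  · exact level_nine_poly_cube_263 p hp
  · exact level_nine_poly_cube_264 p hp
  · exact level_nine_poly_cube_265 p hp
  · exact level_nine_poly_cube_266 p hp
  · exact level_nine_poly_cube_267 p hp
  · exact level_nine_poly_cube_268 p hp
  · exact level_nine_poly_cube_269 p hp
  · exact level_nine_poly_cube_270 p hp
  · exact level_nine_poly_cube_271 p hp
  · exact level_nine_poly_cube_272 p hp
  · exact level_nine_poly_cube_273 p hp
  · exact level_nine_poly_cube_274 p hp
  · exact level_nine_poly_cube_275 p hp
  · exact level_nine_poly_cube_276 p hp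
  · exact level_nine_poly_cube_277 p hp
  · exact level_nine_poly_cube_278 p hp
  · exact level_nine_poly_cube_279 p hp
  · exact level_nine_poly_cube_280 p hp
  · exact level_nine_poly_cube_281 p hp
  · exact level_nine_poly_cube_282 p hp
  · exact level_nine_poly_cube_283 p hp
  · exact level_nine_poly_cube_284 p hp
  · exact level_nine_poly_cube_285 p hp
  · exact level_nine_poly_cube_286 p hp
  · exact level_nine_poly_cube_287 p hp
  · exact level_nine_poly_cube_288 p hp
  · exact level_nine_poly_cube_289 p hp
  · exact level_nine_poly_cube_290 p hp
  · exact level_nine_poly_cube_291 p hp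
  · exact level_nine_poly_cube_292 p hp
  · exact level_nine_poly_cube_293 p hp
  · exact level_nine_poly_cube_294 p hp
  · exact level_nine_poly_cube_295 p hp
  · exact level_nine_poly_cube_296 p hp
  · exact level_nine_poly_cube_297 p hp
  · exact level_nine_poly_cube_298 p hp
  · exact level_nine_poly_cube_299 p hp
  · exact level_nine_poly_cube_300 p hp
  · exact level_nine_poly_cube_301 p hp
  · exact level_nine_poly_cube_302 p hp
  · exact level_nine_poly_cube_303 p hp
  · exact level_nine_poly_cube_304 p hp
  · exact level_nine_poly_cube_305 p hp
  · exact level_nine_poly_cube_306 p hp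
  · exact level_nine_poly_cube_307 p hp
  · exact level_nine_poly_cube_308 p hp
  · exact level_nine_poly_cube_309 p hp
  · exact level_nine_poly_cube_310 p hp
  · exact level_nine_poly_cube_311 p hp
  · exact level_nine_poly_cube_312 p hp
  · exact level_nine_poly_cube_313 p hp
  · exact level_nine_poly_cube_314 p hp
  · exact level_nine_poly_cube_315 p hp
  · exact level_nine_poly_cube_316 p hp
  · exact level_nine_poly_cube_317 p hp
  · exact level_nine_poly_cube_318 p hp
  · exact level_nine_poly_cube_319 p hp
  · exact level_nine_poly_cube_320 p hp
  · exact level_nine_poly_cube_321 p hp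
  · exact level_nine_poly_cube_322 p hp
  · exact level_nine_poly_cube_323 p hp
  · exact level_nine_poly_cube_324 p hp
  · exact level_nine_poly_cube_325 p hp
  · exact level_nine_poly_cube_326 p hp
  · exact level_nine_poly_cube_327 p hp
  · exact level_nine_poly_cube_328 p hp
  · exact level_nine_poly_cube_329 p hp

end ThmN

end PercRepro
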